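/-
Origin: expansion seat `planner-pub-hodgecm-mc-glue-1-0`, handover #1 2026-08-18T18:53Z md5 3d4ff34ee1b6eb00d84489d0e8aebe37 (NEW additive leaf, 243 l., new subdir HodgeCM/Model/Junction/; imports the tree modules HodgeCM.Automorphic.WeilThetaModel + HodgeCM.Automorphic.AdelicUnitaryModel only, NO rewrite; nothing landed imports it; lake env lean vs PKG r31: rc 0, 0 errors, 0 warnings, 0 proof holes; audited names: HodgeCM.WeilThetaModel.comap_θ_mk, HodgeCM.WeilT (`HOME/mc/pub-hodgecm-mc-glue-1/lean/McGlue1/WeilThetaModelComap.lean`, md5 3d4ff34e, 243 lines);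
landed by the packager successor (mc-unitary-1-g3, gen-8 kit) in gate run 32 as `HodgeCM/Model/Junction/WeilThetaModelComap.lean` (verbatim).
-/
import Summits.HodgeConjecture.HodgeCM.Automorphic.WeilThetaModel
import Summits.HodgeConjecture.HodgeCM.Automorphic.AdelicUnitaryModel_2

/-!
# Junction J1: pulling a Weil theta model back along group homomorphisms

E2-INSTANCE-SPEC §3, junction J1 (node E-J of `MODEL-DAG.md`).  The theta-side seats construct the Weil
theta model of a context over the adelic unitary groups `U(V)(𝔸_{L⁺})`, `U(W)(𝔸_{L₀})` themselves, while
the END STATE (`AdelicThetaCore₀.wm`) asks for a `WeilThetaModel` over the MODEL groups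
`(V.latticeModel hP).toQuotientModel.G = ↥(regimeSubgroup L V.Hm)` and
`(c.D.latticeModelW hP).toQuotientModel.G = ↥(regimeSubgroup L diag(a₀, a₁))` (both `rfl`), i.e. over
SUBGROUPS of the adelic unitary groups (all of them in PerL's regime, trivial outside it).

* `WeilThetaModel.comap` : pull a model over `(GU, ΓU, G, Γ)` back along continuous homomorphisms
  `fU : GU' →* GU`, `f : G' →* G` with `fU(ΓU') ⊆ ΓU`, `f(Γ') ⊆ Γ` — the Weil datum, the index space and the
  two PRINT facts are UNCHANGED, only the dual-pair splitting is composed: `s' = s ∘ (fU × f)`;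
* `WeilThetaModel.restrict` : the case of subgroup inclusions `SU ≤ GU`, `S ≤ G` with the lattices
  `ΓU.subgroupOf SU`, `Γ.subgroupOf S`;
* `WeilThetaModel.toRegime` : the END-STATE shape — from a model over the adelic unitary groups of two
  hermitian matrices `HV`, `HW` to the model over `(↥(regimeSubgroup L HV), regimeRat L HV,
  ↥(regimeSubgroup L HW), regimeRat L HW)`, UNIFORMLY in the regime bit (no case split: `regimeRat` is
  literally `(adelicUnitaryRat L H).subgroupOf (regimeSubgroup L H)`);
* the bookkeeping lemmas: `ω`, the kernel upstairs `thetaFun`, the descended kernel `thetaQuot` / `θ` of the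
  pulled-back model are those of the original model evaluated at the images (`comap_thetaFun`, `comap_θ_mk`, …).

Everything here is definitional bookkeeping (kernel-checked, no hypotheses, no cited facts).
-/

set_option autoImplicit false

noncomputable section

namespace HodgeCM

namespace WeilThetaModel

variable {GU : Type} [Group GU] [TopologicalSpace GU] {ΓU : Subgroup GU}
variable {G : Type} [Group G] [TopologicalSpace G] {Γ : Subgroup G}
variable {GU' : Type} [Group GU'] [TopologicalSpace GU'] {ΓU' : Subgroup GU'}
variable {G' : Type} [Group G'] [TopologicalSpace G'] {Γ' : Subgroup G'}

/-! ## 1. `comap` along continuous homomorphisms compatible with the lattices -/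

/-- **Pull-back of a Weil theta model** along continuous homomorphisms `fU : GU' →* GU`, `f : G' →* G`
carrying `ΓU'` into `ΓU` and `Γ'` into `Γ`: same Weil datum `W`, same index space `SK`, same PRINT facts;
the splitting becomes `s ∘ (fU × f)`. -/
def comap (M : WeilThetaModel GU ΓU G Γ) (fU : GU' →* GU) (hfU : Continuous fU) (f : G' →* G)
    (hf : Continuous f) (hΓU : ∀ γ ∈ ΓU', fU γ ∈ ΓU) (hΓ : ∀ γ ∈ Γ', f γ ∈ Γ) :
    WeilThetaModel GU' ΓU' G' Γ' where
  W := M.W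
  act_one := M.act_one
  theta_act := M.theta_act
  actionContinuous := M.actionContinuous
  thetaContinuousInvariant := M.thetaContinuousInvariant
  dist_cont := M.dist_cont
  s := M.s.comp (fU.prodMap f)
  s_cont := M.s_cont.comp ((hfU.comp continuous_fst).prodMk (hf.comp continuous_snd))
  s_rat γU hγU γ hγ := M.s_rat (fU γU) (hΓU γU hγU) (f γ) (hΓ γ hγ)
  SK := M.SK
  SK_stable h Φ hΦ := by
    simpa only [MonoidHom.coe_comp, Function.comp_apply, MonoidHom.prodMap_def, MonoidHom.prod_apply,
      MonoidHom.coe_fst, MonoidHom.coe_snd, map_one] using M.SK_stable (f h) Φ hΦ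

section

variable (M : WeilThetaModel GU ΓU G Γ) (fU : GU' →* GU) (hfU : Continuous fU) (f : G' →* G)
  (hf : Continuous f) (hΓU : ∀ γ ∈ ΓU', fU γ ∈ ΓU) (hΓ : ∀ γ ∈ Γ', f γ ∈ Γ)

/-- (Ported verbatim from the HodgeCMPerL package; no docstring in the source.) -/
@[simp] theorem comap_W : (M.comap fU hfU f hf hΓU hΓ).W = M.W := rfl

/-- (Ported verbatim from the HodgeCMPerL package; no docstring in the source.) -/
@[simp] theorem comap_SK : (M.comap fU hfU f hf hΓU hΓ).SK = M.SK := rfl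

/-- (Ported verbatim from the HodgeCMPerL package; no docstring in the source.) -/
@[simp] theorem comap_s_apply (p : GU' × G') :
    (M.comap fU hfU f hf hΓU hΓ).s p = M.s (fU p.1, f p.2) := rfl

/-- (Ported verbatim from the HodgeCMPerL package; no docstring in the source.) -/
theorem comap_s_mk (x : GU') (y : G') : (M.comap fU hfU f hf hΓU hΓ).s (x, y) = M.s (fU x, f y) := rfl

/-- `ω'(h) = ω(f h)` on the (unchanged) index space. -/
@[simp] theorem coe_comap_omg (h : G') (Φ : (M.comap fU hfU f hf hΓU hΓ).SK) :
    ((M.comap fU hfU f hf hΓU hΓ).omg h Φ).1 = (M.omg (f h) ⟨Φ.1, Φ.2⟩).1 := by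
  show M.W.act (M.s (fU 1, f h)) Φ.1 = M.W.act (M.s (1, f h)) Φ.1
  rw [map_one]

/-- (Ported verbatim from the HodgeCMPerL package; no docstring in the source.) -/
theorem comap_omg (h : G') (Φ : (M.comap fU hfU f hf hΓU hΓ).SK) :
    (M.comap fU hfU f hf hΓU hΓ).omg h Φ = M.omg (f h) ⟨Φ.1, Φ.2⟩ :=
  Subtype.ext (coe_comap_omg M fU hfU f hf hΓU hΓ h Φ)

/-- The kernel upstairs of the pulled-back model is the original kernel at the images. -/
@[simp] theorem comap_thetaFun (Φ : M.W.SX) (p : GU' × G') :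
    (M.comap fU hfU f hf hΓU hΓ).thetaFun Φ p = M.thetaFun Φ (fU p.1, f p.2) := by
  obtain ⟨x, y⟩ := p
  show M.W.theta Φ (M.s (fU x⁻¹, f y⁻¹)) = M.W.theta Φ (M.s (fU x, f y)⁻¹)
  rw [Prod.inv_mk, map_inv, map_inv]

/-- (Ported verbatim from the HodgeCMPerL package; no docstring in the source.) -/
theorem comap_thetaFun_mk (Φ : M.W.SX) (x : GU') (y : G') :
    (M.comap fU hfU f hf hΓU hΓ).thetaFun Φ (x, y) = M.thetaFun Φ (fU x, f y) :=
  comap_thetaFun M fU hfU f hf hΓU hΓ Φ (x, y)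

/-- The descended kernel of the pulled-back model, on cosets of elements. -/
@[simp] theorem comap_thetaQuot_mk (Φ : M.W.SX) (x : GU') (y : G') :
    (M.comap fU hfU f hf hΓU hΓ).thetaQuot Φ (QuotientGroup.mk x, QuotientGroup.mk y) =
      M.thetaQuot Φ (QuotientGroup.mk (fU x), QuotientGroup.mk (f y)) := by
  rw [thetaQuot_mk, thetaQuot_mk, comap_thetaFun_mk]

variable [IsTopologicalGroup GU] [IsTopologicalGroup G] [IsTopologicalGroup GU'] [IsTopologicalGroup G']

/-- The theta kernels `θ_Φ` of the pulled-back model, on cosets of elements. -/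
@[simp] theorem comap_θ_mk (Φ : (M.comap fU hfU f hf hΓU hΓ).SK) (x : GU') (y : G') :
    (M.comap fU hfU f hf hΓU hΓ).θ Φ (QuotientGroup.mk x, QuotientGroup.mk y) =
      M.θ ⟨Φ.1, Φ.2⟩ (QuotientGroup.mk (fU x), QuotientGroup.mk (f y)) := by
  rw [θ_mk, θ_mk]
  exact comap_thetaFun_mk M fU hfU f hf hΓU hΓ Φ.1 x y

end

/-! ## 2. Restriction to subgroups -/

/-- **Restriction of a Weil theta model to subgroups** `SU ≤ GU`, `S ≤ G`, with the induced lattices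
`ΓU ∩ SU`, `Γ ∩ S` (as `Subgroup.subgroupOf`). -/
def restrict (M : WeilThetaModel GU ΓU G Γ) (SU : Subgroup GU) (S : Subgroup G) :
    WeilThetaModel ↥SU (ΓU.subgroupOf SU) ↥S (Γ.subgroupOf S) :=
  M.comap SU.subtype continuous_subtype_val S.subtype continuous_subtype_val
    (fun _ h => Subgroup.mem_subgroupOf.1 h) (fun _ h => Subgroup.mem_subgroupOf.1 h)

section

variable (M : WeilThetaModel GU ΓU G Γ) (SU : Subgroup GU) (S : Subgroup G)

/-- (Ported verbatim from the HodgeCMPerL package; no docstring in the source.) -/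
theorem restrict_def : M.restrict SU S =
    M.comap SU.subtype continuous_subtype_val S.subtype continuous_subtype_val
      (fun _ h => Subgroup.mem_subgroupOf.1 h) (fun _ h => Subgroup.mem_subgroupOf.1 h) := rfl

/-- (Ported verbatim from the HodgeCMPerL package; no docstring in the source.) -/
@[simp] theorem restrict_W : (M.restrict SU S).W = M.W := rfl

/-- (Ported verbatim from the HodgeCMPerL package; no docstring in the source.) -/
@[simp] theorem restrict_SK : (M.restrict SU S).SK = M.SK := rfl

/-- (Ported verbatim from the HodgeCMPerL package; no docstring in the source.) -/
@[simp] theorem restrict_s_apply (p : ↥SU × ↥S) : (M.restrict SU S).s p = M.s ((p.1 : GU), (p.2 : G)) := rfl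

/-- (Ported verbatim from the HodgeCMPerL package; no docstring in the source.) -/
@[simp] theorem coe_restrict_omg (h : ↥S) (Φ : (M.restrict SU S).SK) :
    ((M.restrict SU S).omg h Φ).1 = (M.omg (h : G) ⟨Φ.1, Φ.2⟩).1 :=
  coe_comap_omg M _ _ _ _ _ _ h Φ

/-- (Ported verbatim from the HodgeCMPerL package; no docstring in the source.) -/
@[simp] theorem restrict_thetaFun (Φ : M.W.SX) (p : ↥SU × ↥S) :
    (M.restrict SU S).thetaFun Φ p = M.thetaFun Φ ((p.1 : GU), (p.2 : G)) :=
  comap_thetaFun M _ _ _ _ _ _ Φ p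

/-- (Ported verbatim from the HodgeCMPerL package; no docstring in the source.) -/
@[simp] theorem restrict_thetaQuot_mk (Φ : M.W.SX) (x : ↥SU) (y : ↥S) :
    (M.restrict SU S).thetaQuot Φ (QuotientGroup.mk x, QuotientGroup.mk y) =
      M.thetaQuot Φ (QuotientGroup.mk (x : GU), QuotientGroup.mk (y : G)) :=
  comap_thetaQuot_mk M _ _ _ _ _ _ Φ x y

variable [IsTopologicalGroup GU] [IsTopologicalGroup G]

/-- (Ported verbatim from the HodgeCMPerL package; no docstring in the source.) -/
@[simp] theorem restrict_θ_mk (Φ : (M.restrict SU S).SK) (x : ↥SU) (y : ↥S) :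
    (M.restrict SU S).θ Φ (QuotientGroup.mk x, QuotientGroup.mk y) =
      M.θ ⟨Φ.1, Φ.2⟩ (QuotientGroup.mk (x : GU), QuotientGroup.mk (y : G)) :=
  comap_θ_mk M _ _ _ _ _ _ Φ x y

end

end WeilThetaModel

/-! ## 3. The END-STATE shape: models over the regime subgroups -/

namespace WeilThetaModel

open HodgeCM.Adelic

variable {L : CMField} {nV nW : Type} [Fintype nV] [DecidableEq nV] [Fintype nW] [DecidableEq nW]
  {HV : Matrix nV nV L} {HW : Matrix nW nW L}

/-- **From a Weil theta model over the adelic unitary groups to the model over the regime subgroups**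
(`= ` the model groups of `CocompactLatticeModel.ofHermitianRegime`, hence of `HermSpace3.latticeModel` and
`SeesawDatum.latticeModelW`), uniformly in the regime bit. -/
def toRegime
    (M : WeilThetaModel (adelicUnitaryGroup L HV) (adelicUnitaryRat L HV)
      (adelicUnitaryGroup L HW) (adelicUnitaryRat L HW)) :
    WeilThetaModel ↥(regimeSubgroup L HV) (regimeRat L HV) ↥(regimeSubgroup L HW) (regimeRat L HW) :=
  M.restrict (regimeSubgroup L HV) (regimeSubgroup L HW)

section

variable (M : WeilThetaModel (adelicUnitaryGroup L HV) (adelicUnitaryRat L HV)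
  (adelicUnitaryGroup L HW) (adelicUnitaryRat L HW))

/-- (Ported verbatim from the HodgeCMPerL package; no docstring in the source.) -/
theorem toRegime_def :
    toRegime M = M.restrict (regimeSubgroup L HV) (regimeSubgroup L HW) := rfl

/-- (Ported verbatim from the HodgeCMPerL package; no docstring in the source.) -/
@[simp] theorem toRegime_W : (toRegime M).W = M.W := rfl

/-- (Ported verbatim from the HodgeCMPerL package; no docstring in the source.) -/
@[simp] theorem toRegime_SK : (toRegime M).SK = M.SK := rfl

/-- (Ported verbatim from the HodgeCMPerL package; no docstring in the source.) -/
@[simp] theorem toRegime_s_apply (p : ↥(regimeSubgroup L HV) × ↥(regimeSubgroup L HW)) :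
    (toRegime M).s p = M.s ((p.1 : adelicUnitaryGroup L HV), (p.2 : adelicUnitaryGroup L HW)) :=
  rfl

/-- (Ported verbatim from the HodgeCMPerL package; no docstring in the source.) -/
@[simp] theorem toRegime_thetaFun (Φ : M.W.SX)
    (p : ↥(regimeSubgroup L HV) × ↥(regimeSubgroup L HW)) :
    (toRegime M).thetaFun Φ p =
      M.thetaFun Φ ((p.1 : adelicUnitaryGroup L HV), (p.2 : adelicUnitaryGroup L HW)) :=
  restrict_thetaFun M _ _ Φ p

/-- (Ported verbatim from the HodgeCMPerL package; no docstring in the source.) -/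
@[simp] theorem toRegime_θ_mk (Φ : (toRegime M).SK)
    (x : ↥(regimeSubgroup L HV)) (y : ↥(regimeSubgroup L HW)) :
    (toRegime M).θ Φ (QuotientGroup.mk x, QuotientGroup.mk y) =
      M.θ ⟨Φ.1, Φ.2⟩ (QuotientGroup.mk (x : adelicUnitaryGroup L HV),
        QuotientGroup.mk (y : adelicUnitaryGroup L HW)) :=
  restrict_θ_mk M _ _ Φ x y

/-- In the regime, through `regimeEquiv`: the kernels of the regime model ARE the original kernels. -/
theorem toRegime_θ_mk_regimeEquiv (hV : IsAnisotropic L HV) (hW : IsAnisotropic L HW)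
    (Φ : (toRegime M).SK) (x : adelicUnitaryGroup L HV) (y : adelicUnitaryGroup L HW) :
    (toRegime M).θ Φ
        (QuotientGroup.mk (regimeEquiv L HV hV x), QuotientGroup.mk (regimeEquiv L HW hW y)) =
      M.θ ⟨Φ.1, Φ.2⟩ (QuotientGroup.mk x, QuotientGroup.mk y) :=
  toRegime_θ_mk M Φ _ _

end

/-- **The END-STATE field shape**: a Weil theta model over the adelic unitary groups of `V.Hm` and of the
context's plane `diag(a₀, a₁)` gives `wm V c` over the model groups of `latticeModel` / `latticeModelW`
(the carrier identifications are `rfl`: `latticeModel_G/Γ`, `latticeModelW_G/Γ`, `ofLattice_G/Γ`). -/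
def toLatticeModels (hP : PrintFact_unitaryCompact) {ι₁ : L →+* ℂ} (V : HermSpace3 L ι₁)
    (S : StubTree.SeesawDatum L)
    (M : WeilThetaModel (adelicUnitaryGroup L V.Hm) (adelicUnitaryRat L V.Hm)
      (adelicUnitaryGroup L (Matrix.diagonal ![S.a 0, S.a 1]))
      (adelicUnitaryRat L (Matrix.diagonal ![S.a 0, S.a 1]))) :
    WeilThetaModel (V.latticeModel hP).toQuotientModel.G (V.latticeModel hP).toQuotientModel.Γ
      (S.latticeModelW hP).toQuotientModel.G (S.latticeModelW hP).toQuotientModel.Γ :=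
  toRegime M

/-- (Ported verbatim from the HodgeCMPerL package; no docstring in the source.) -/
theorem toLatticeModels_eq (hP : PrintFact_unitaryCompact) {ι₁ : L →+* ℂ}
    (V : HermSpace3 L ι₁) (S : StubTree.SeesawDatum L)
    (M : WeilThetaModel (adelicUnitaryGroup L V.Hm) (adelicUnitaryRat L V.Hm)
      (adelicUnitaryGroup L (Matrix.diagonal ![S.a 0, S.a 1]))
      (adelicUnitaryRat L (Matrix.diagonal ![S.a 0, S.a 1]))) :
    toLatticeModels hP V S M = toRegime M := rfl

end WeilThetaModel

end HodgeCM

end
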